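import Literature.NumberTheory.Automorphic.UnitaryGroupArchTestLift      -- ★ p02 (g8): `contDiffAt_dite_isUnit_of_isArchSmooth`, `dite_isUnit_eq_zero_of_notMem` (the zero-extension of an `IsArchSmooth` function)
import Literature.NumberTheory.Rogawski1990.ArchimedeanTransfer           -- ★ `ArchSmooth`, `ArchSmooth₂`, `endoEmbArch`
import HarnessLib

/-!
# `ArchSmooth` ∕ `ArchSmooth₂` test functions ARE restrictions of AMBIENT smooth compactly supported functions on the matrix algebra `M_N(L ⊗ ℝ)`
# (the letters' `C_c^∞` currency ⟶ the `ContDiff ℝ ⊤ Θ` currency of ★ (V7)-smooth ∕ ★ (R1-a) ∕ ★ `ArchEndoscopicCentralDescent`; Borel–Jacquet §4.1, Rogawski §14.3)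

Topic `NumberTheory/Rogawski1990`; namespaces `Literature.NumberTheory.Automorphic.UnitaryGroup` (§1) and `Literature.NumberTheory.Rogawski1990` (§2).  THEOREMS ONLY (no `def`,
no instance, no notation, no axiom, no named fact, no `sorry`).  Cell `pub/hodgecm-mathlib`, ENGINE T1 (crux H413 = `stmt-HodgeConjecture-24833`); ROAD-Sd residual R3 «(S-c) central
vanishing» (`stub_ScCore`), brick (R3-f) step 3A of the census 2026-09-01T05:27Z; author F0P3a-p02 (g10).

WHY.  The letters (★ `ArchTransfersExistCanonical`, `IsArchDeltaTransfer`, …) quantify over `a′ : G′_∞ → ℂ` with `ArchSmooth L 3 H′ a′` and `aH : H_∞ → ℂ` with `ArchSmooth₂ L aH`: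
restrictions of a continuous compactly supported `φ` on `GL_N(L ⊗ ℝ)` that is smooth UNDER RIGHT TRANSLATIONS (★ `IsArchSmooth`, exponential charts).  The analysis files of the (S-c) ∕
(L-use) roads (★ (V7)-smooth `contDiff_partialOrbital`, ★ (R1-a) `exists_contDiff_eq_integral_insert`, ★ `ArchRankOneLimitFormulaPartial`, ★ `ArchEndoscopicCentralDescent`, ★ A-p18
`ArchCompactPlaceOrbitalSmooth`) take instead an AMBIENT `Θ : M_N(L ⊗ ℝ) → E`, `ContDiff ℝ ⊤ Θ`, compactly supported on the group.  ★ `UnitaryGroupArchTestLift` (p02 g8) built the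
bridge for PURE TENSORS (`exists_smooth_lift_of_isArchTest`); this file states it for the bare predicates the letters use, so that (R3-f) ∕ R1 assemblies `obtain` their `Θ` in one line.

WHAT IS PROVED.
§1 `exists_contDiff_hasCompactSupport_of_isArchSmooth` — every compactly supported `IsArchSmooth` function on `GL_N(L ⊗ ℝ)` is the restriction of an ambient `Θ`, `ContDiff ℝ ∞`,
   compactly supported INSIDE the units (the zero-extension; smooth at units by the logarithmic chart ★, locally zero at non-units).
§2 **`ArchSmooth.exists_contDiff`** (`a = Θ ∘ val` on `U(H)(L⁺ ⊗ ℝ)`, with BOTH `HasCompactSupport Θ` and the restricted form `HasCompactSupport (g ↦ Θ ↑↑g)` that ★ (R1-a) asks for) and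
   **`ArchSmooth₂.exists_contDiff`** (`aH = Θ ∘ val ∘ ι_∞` on `H_∞`, `Θ` on `M₃(L ⊗ ℝ)`).
HONEST LABEL: HC_CM is proved only modulo the 7 printed citations until rung 0 closes; this file is calculus plumbing and pays nothing by itself.

## References
* [BorelJacquet1979] A. Borel, H. Jacquet, *Automorphic forms and automorphic representations*, PSPM 33.1 (1979), §1.1, §4.1 (smooth compactly supported functions on `G_∞`).
* [Rogawski1990] J. D. Rogawski, *Automorphic Representations of Unitary Groups in Three Variables*, Ann. of Math. Stud. 123 (1990), §14.2 p. 233; §14.3 p. 234.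
-/

set_option autoImplicit false

noncomputable section

-- `Classical` is needed to see the Mathlib normed-space instances on `mixedSpace L` (note H5 of ★ `AdelicGLnGlue`); the Banach algebra structure of `M_N(L ⊗ ℝ)` is the scoped operator norm
open scoped MatrixGroups Matrix ContDiff Classical Topology
open NumberField NumberField.mixedEmbedding Filter Set Function

namespace Literature.NumberTheory.Automorphic.UnitaryGroup

open scoped Matrix.Norms.Operator

/-! ## §1 The zero-extension of a compactly supported `IsArchSmooth` function -/

section Lift

variable {L : Type} [Field L] [NumberField L] [IsCMField L] {N : ℕ}

omit [IsCMField L] in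
/-- **A compactly supported `IsArchSmooth` function on `GL_N(L ⊗ ℝ)` is the restriction of an ambient smooth compactly supported function on `M_N(L ⊗ ℝ)`** — its
zero-extension: `ContDiff ℝ ∞` (★ `contDiffAt_dite_isUnit_of_isArchSmooth` at units, locally zero at non-units ★ `dite_isUnit_eq_zero_of_notMem`), support `= val(tsupport φ)` compact and
inside the units. [cite: BorelJacquet1979, §1.1 and §4.1] -/
theorem exists_contDiff_hasCompactSupport_of_isArchSmooth (φ : GL (Fin N) (mixedSpace L) → ℂ) (hφs : HasCompactSupport φ)
    (hφsm : IsArchSmooth (archGroupGL N L).carrier.subtype φ) :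
    ∃ Θ : Matrix (Fin N) (Fin N) (mixedSpace L) → ℂ, ContDiff ℝ ∞ Θ ∧ HasCompactSupport Θ ∧ tsupport Θ ⊆ {M | IsUnit M} ∧
      ∀ g : GL (Fin N) (mixedSpace L), φ g = Θ (g : Matrix (Fin N) (Fin N) (mixedSpace L)) := by
  -- the compact set of units carrying the support
  obtain ⟨C, hCdef⟩ : ∃ C : Set (Matrix (Fin N) (Fin N) (mixedSpace L)),
      C = (fun z : GL (Fin N) (mixedSpace L) => (z : Matrix (Fin N) (Fin N) (mixedSpace L))) '' tsupport φ := ⟨_, rfl⟩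
  have hCc : IsCompact C := by rw [hCdef]; exact hφs.image Units.continuous_val
  have hCu : C ⊆ {M | IsUnit M} := by
    rw [hCdef]; rintro _ ⟨z, -, rfl⟩; exact Units.isUnit z
  refine ⟨fun q => if h : IsUnit q then φ h.unit else 0, ?_, ?_, ?_, fun g => ?_⟩
  · rw [contDiff_iff_contDiffAt]
    intro q
    by_cases h : IsUnit q
    · obtain ⟨u, rfl⟩ := h
      exact contDiffAt_dite_isUnit_of_isArchSmooth hφsm u
    · have hqC : q ∉ C := fun h' => h (hCu h')
      refine (contDiffAt_const (c := (0 : ℂ))).congr_of_eventuallyEq ?_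
      filter_upwards [hCc.isClosed.isOpen_compl.mem_nhds hqC] with q' hq'
      exact dite_isUnit_eq_zero_of_notMem (by rw [hCdef] at hq'; exact hq')
  · exact HasCompactSupport.intro hCc fun q hq => dite_isUnit_eq_zero_of_notMem (by rw [hCdef] at hq; exact hq)
  · refine (closure_minimal (fun q hq => ?_) hCc.isClosed).trans hCu
    by_contra hqC
    exact hq (dite_isUnit_eq_zero_of_notMem (by rw [hCdef] at hqC; exact hqC))
  · change φ g = (if h : IsUnit ((g : GL (Fin N) (mixedSpace L)) : Matrix (Fin N) (Fin N) (mixedSpace L)) then φ h.unit else 0)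
    rw [dif_pos (Units.isUnit _), IsUnit.unit_of_val_units]

end Lift

end Literature.NumberTheory.Automorphic.UnitaryGroup

/-! ## §2 The letters' predicates -/

namespace Literature.NumberTheory.Rogawski1990

open Literature.NumberTheory.Automorphic Literature.NumberTheory.Automorphic.UnitaryGroup
open scoped Matrix.Norms.Operator

section Letters

variable {L : Type} [Field L] [NumberField L] [IsCMField L] {N : ℕ} {H : Matrix (Fin N) (Fin N) L}

/-- **`ArchSmooth L N H a` ⟹ `a` is the restriction of an ambient `Θ : M_N(L ⊗ ℝ) → ℂ`, `ContDiff ℝ ∞`, compactly supported (ambiently AND on the group)** — the binders `(Θ) (hΘ : ContDiff ℝ ⊤ Θ)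
(hΘc : HasCompactSupport fun g => Θ ↑↑g)` of ★ (R1-a) ∕ ★ (V7)-smooth ∕ ★ `ArchEndoscopicCentralDescent`, produced from the letters' `C_c^∞(G′_∞)` clause.
[cite: BorelJacquet1979, §4.1] [cite: Rogawski1990, §14.2 p. 233] -/
theorem ArchSmooth.exists_contDiff {a : UnitaryGroup.arch (↥(maximalRealSubfield L)) L (IsCMField.complexConj L) N H → ℂ} (ha : ArchSmooth L N H a) :
    ∃ Θ : Matrix (Fin N) (Fin N) (mixedSpace L) → ℂ, ContDiff ℝ ∞ Θ ∧ HasCompactSupport Θ ∧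
      HasCompactSupport (fun g : UnitaryGroup.arch (↥(maximalRealSubfield L)) L (IsCMField.complexConj L) N H =>
        Θ ((g : GL (Fin N) (mixedSpace L)) : Matrix (Fin N) (Fin N) (mixedSpace L))) ∧
      ∀ k : UnitaryGroup.arch (↥(maximalRealSubfield L)) L (IsCMField.complexConj L) N H,
        a k = Θ ((k : GL (Fin N) (mixedSpace L)) : Matrix (Fin N) (Fin N) (mixedSpace L)) := by
  have hac : HasCompactSupport a := ha.hasCompactSupport
  obtain ⟨φ, -, hφs, hφsm, hφa⟩ := ha
  obtain ⟨Θ, hΘ, hΘc, -, hΘφ⟩ := exists_contDiff_hasCompactSupport_of_isArchSmooth φ hφs hφsm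
  refine ⟨Θ, hΘ, hΘc, ?_, fun k => (hφa k).trans (hΘφ _)⟩
  have e : (fun g : UnitaryGroup.arch (↥(maximalRealSubfield L)) L (IsCMField.complexConj L) N H =>
      Θ ((g : GL (Fin N) (mixedSpace L)) : Matrix (Fin N) (Fin N) (mixedSpace L))) = a := funext fun k => ((hφa k).trans (hΘφ _)).symm
  rw [e]
  exact hac

/-- **`ArchSmooth₂ L aH` ⟹ `aH = Θ ∘ val ∘ ι_∞`** for an ambient `Θ : M₃(L ⊗ ℝ) → ℂ`, `ContDiff ℝ ∞`, compactly supported: the endoscopic test function read on the matrix algebra through the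
CLOSED embedding `ι_∞ : H_∞ ↪ U(Φ₃)_∞ ↪ GL₃(L ⊗ ℝ)` (★ `endoEmbArch`). [cite: Rogawski1990, §14.3 p. 234] [cite: BorelJacquet1979, §4.1] -/
theorem ArchSmooth₂.exists_contDiff
    {aH : (UnitaryGroup.arch (↥(maximalRealSubfield L)) L (IsCMField.complexConj L) 2 (Matrix.of fun i j : Fin 2 => if i.val + j.val + 1 = 2 then (1 : L) else 0) ×
      UnitaryGroup.arch (↥(maximalRealSubfield L)) L (IsCMField.complexConj L) 1 (Matrix.of fun i j : Fin 1 => if i.val + j.val + 1 = 1 then (1 : L) else 0)) → ℂ}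
    (haH : ArchSmooth₂ L aH) :
    ∃ Θ : Matrix (Fin 3) (Fin 3) (mixedSpace L) → ℂ, ContDiff ℝ ∞ Θ ∧ HasCompactSupport Θ ∧
      ∀ k, aH k = Θ (((endoEmbArch L k).val : GL (Fin 3) (mixedSpace L)) : Matrix (Fin 3) (Fin 3) (mixedSpace L)) := by
  obtain ⟨φ, -, hφs, hφsm, hφa⟩ := haH
  obtain ⟨Θ, hΘ, hΘc, -, hΘφ⟩ := exists_contDiff_hasCompactSupport_of_isArchSmooth φ hφs hφsm
  exact ⟨Θ, hΘ, hΘc, fun k => (hφa k).trans (hΘφ _)⟩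

end Letters

end Literature.NumberTheory.Rogawski1990

end
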